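import Literature.Geometry.PolyhedralFans.FlagCones
import Literature.Geometry.PolyhedralFans.MultiStarSubdivision
import HarnessLib

/-!
# The barycentric subdivision as an iterated star subdivision: stages, structure, separation

Topic: `Literature/Geometry/PolyhedralFans` (block A3 "Sd via starIter" of the LINKED-KKMS
programme; continuation of `FlagCones` (res-lit-3) and `MultiStarSubdivision`). G. Kempf,
F. Knudsen, D. Mumford, B. Saint-Donat, *Toroidal Embeddings I* (LNM 339, 1973), Ch. II §2: the
barycentric subdivision of a conical polyhedral complex is obtained by starring the cells at their
barycentres IN ORDER OF DECREASING DIMENSION, and its cells are the flag cones of the chains of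
cells; G. Ewald, *Combinatorial Convexity and Algebraic Geometry*, III §2 (stellar and barycentric
subdivisions); W. Fulton, *Introduction to Toric Varieties*, §2.6 p. 47.

We describe every intermediate STAGE. For a rational fan `Δ₀` and an upward closed set `𝒰` of
(nonzero) cones of `Δ₀` — "the cones already starred" — the STAGE CONES are the joins
`ρ + flagCone Φ` with `ρ ∈ Δ₀ ∖ 𝒰` and `Φ ⊆ 𝒰` a chain of cones strictly above `ρ`.

* `Fan.stageRep_unique` — **unique representation**: a point of a stage cone determines its
  `ρ`-component and its positive barycentric coefficients (peel off the top barycentre: a point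
  with a positive coefficient at `bary φ*` lies in no proper face of `φ*`);
* `Fan.le_of_bary_mem_stageCone`, `Fan.mem_chain_of_bary_mem_stageCone` — where the barycentres
  of unstarred / starred cones can lie (pv-2's (c) "membership/uniqueness");
* `Fan.starSubdivision_stageCones` — **one barycentric star**: if the current fan has exactly the
  stage cones of `𝒰` and `φ₀ ∉ 𝒰` is maximal among the unstarred cones, the star subdivision
  through `bary φ₀` has exactly the stage cones of `𝒰 ∪ {φ₀}`;
* `Fan.stage_separated` — two maximal unstarred cones have barycentres in no common stage cone
  (pv-2's (a) "stage separation", the hypothesis of `IsOrdFunction.multiStar`);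
* `Fan.starIter_stageCones` — a BATCH of pairwise incomparable maximal unstarred cones, starred in
  any order, yields the stage cones of `𝒰 ∪ batch`;
* dimension packaging (pv-2's (b)): with `𝒰_d = {φ : d < dim φ}` (`upward_dimGt`) and the batch
  `B_d` of the `d`-dimensional cones (`batch_dimEq`), `Fan.starIter_dimStage` passes from stage
  `d` to stage `d − 1`, `Fan.dimStage_separated` separates `B_d`, `Fan.stageCones_dimTop` starts
  the induction, and at `d = 0` the stage cones are the flag cones of all chains of nonzero cones
  (`Fan.stageCones_dimZero_iff`, the FLAG FAN; simplicial: `Fan.isSimplicial_of_dimZero`);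
* `Fan.chain_subset_of_mem_flagCone` — a positive combination of the barycentres of a chain `Φ`
  lying in the flag cone of a chain `Ψ` forces `Φ ⊆ Ψ` (pv-2's (c), for orbit separation).

Definition: `Fan.stageCones` (the only `def`).

References: [KempfEtAl1973] Ch. II §2; [Ewald1996] III §2; [Fulton1993Toric] §2.6 p. 47.
-/

noncomputable section

namespace Literature.Geometry.PolyhedralFans

open PointedCone Finset

variable {κ : Type*}

namespace Fan

variable {Δ : Fan ℚ (κ → ℚ)}

/-! ## Points with a positive top barycentric coefficient -/

/-- A combination `r + Σ_{φ ∈ Φ} λ_φ b_φ` with `r ∈ ρ ≤ μ`, all `φ ≤ μ` and `λ ≥ 0` lies in `μ`.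
[cite: KempfEtAl1973, II §2] -/
theorem rep_mem_of_le {ρ μ : PointedCone ℚ (κ → ℚ)} {r : κ → ℚ} (hr : r ∈ ρ) (hρμ : ρ ≤ μ)
    {Φ : Finset (PointedCone ℚ (κ → ℚ))} (hΦ : ∀ φ ∈ Φ, φ ∈ Δ.cones) (hΦμ : ∀ φ ∈ Φ, φ ≤ μ)
    {lam : PointedCone ℚ (κ → ℚ) → ℚ} (hlam : ∀ φ ∈ Φ, 0 ≤ lam φ) :
    r + ∑ φ ∈ Φ, lam φ • bary φ ∈ μ :=
  μ.add_mem (hρμ hr) (μ.sum_mem fun φ hφ =>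
    smul_mem_of_nonneg (hΦμ φ hφ (bary_mem (Δ.fg (hΦ φ hφ)))) (hlam φ hφ))

/-- **A point with a positive coefficient at `bary μ`, all other summands in `μ`, lies in no proper
face of `μ`** (the face would contain `bary μ`). [cite: KempfEtAl1973, II §2] -/
theorem eq_of_isFaceOf_of_rep_mem (hΔ : Δ.IsRational) {μ : PointedCone ℚ (κ → ℚ)}
    (hμ : μ ∈ Δ.cones) {y : κ → ℚ} (hy : y ∈ μ) {c : ℚ} (hc : 0 < c)
    {F : PointedCone ℚ (κ → ℚ)} (hF : F.IsFaceOf μ) (hx : c • bary μ + y ∈ F) : F = μ :=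
  eq_of_isFaceOf_of_bary_mem (hΔ hμ) (Δ.salient hμ) hF
    (hF.mem_of_smul_add_mem (bary_mem (Δ.fg hμ)) hy hc hx)

/-- A point of a cone `C ≤ μ`, `C ≠ μ` (`C` a cone of the fan), lies in the proper face `C` of `μ`;
so a point lying in no proper face of `μ` is not in `C`. [cite: Fulton1993Toric, §1.4 p. 20] -/
theorem not_mem_of_forall_isFaceOf {μ C : PointedCone ℚ (κ → ℚ)} (hμ : μ ∈ Δ.cones)
    (hC : C ∈ Δ.cones) (hCμ : C ≤ μ) (hne : C ≠ μ) {x : κ → ℚ}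
    (hx : ∀ F : PointedCone ℚ (κ → ℚ), F.IsFaceOf μ → x ∈ F → F = μ) : x ∉ C :=
  fun hxC => hne (hx C (Δ.isFaceOf_of_le hμ hC hCμ) hxC)

/-! ## Unique representation in stage cones -/

/-- **Unique representation of points of stage cones.** Let `𝒰` be an upward closed set of cones
of the rational fan `Δ` ("already starred"). If
`r + Σ_{φ ∈ Φ} λ_φ b_φ = r' + Σ_{ψ ∈ Ψ} μ_ψ b_ψ` with `r ∈ ρ`, `r' ∈ ρ'`, `ρ, ρ' ∈ Δ ∖ 𝒰`,
`Φ, Ψ ⊆ 𝒰` chains above `ρ` resp. `ρ'`, and all coefficients POSITIVE, then `Φ = Ψ`, the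
coefficients agree, and `r = r'`. (Peel off the top: both sides lie in no proper face of their top
cone, so the tops coincide; unequal top coefficients would put a point with positive top
coefficient into a proper face.) [cite: KempfEtAl1973, II §2] -/
theorem stageRep_unique (hΔ : Δ.IsRational) {𝒰 : Set (PointedCone ℚ (κ → ℚ))}
    (h𝒰 : 𝒰 ⊆ Δ.cones) (hup : ∀ φ ∈ 𝒰, ∀ ψ ∈ Δ.cones, φ ≤ ψ → ψ ∈ 𝒰) :
    ∀ (n : ℕ) {ρ ρ' : PointedCone ℚ (κ → ℚ)} {r r' : κ → ℚ} {Φ Ψ : Finset (PointedCone ℚ (κ → ℚ))}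
      {lam mu : PointedCone ℚ (κ → ℚ) → ℚ}, Φ.card + Ψ.card ≤ n →
      ρ ∈ Δ.cones → ρ ∉ 𝒰 → r ∈ ρ → (↑Φ ⊆ 𝒰) → IsChain (· ≤ ·) (Φ : Set (PointedCone ℚ (κ → ℚ))) →
      (∀ φ ∈ Φ, ρ ≤ φ) → (∀ φ ∈ Φ, 0 < lam φ) →
      ρ' ∈ Δ.cones → ρ' ∉ 𝒰 → r' ∈ ρ' → (↑Ψ ⊆ 𝒰) → IsChain (· ≤ ·) (Ψ : Set (PointedCone ℚ (κ → ℚ))) →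
      (∀ ψ ∈ Ψ, ρ' ≤ ψ) → (∀ ψ ∈ Ψ, 0 < mu ψ) →
      r + ∑ φ ∈ Φ, lam φ • bary φ = r' + ∑ ψ ∈ Ψ, mu ψ • bary ψ →
      Φ = Ψ ∧ (∀ φ ∈ Φ, lam φ = mu φ) ∧ r = r' := by
  classical
  intro n
  induction n using Nat.strong_induction_on with
  | _ n ih =>
  intro ρ ρ' r r' Φ Ψ lam mu hn hρ hρ𝒰 hr hΦ hΦch hΦρ hlam hρ' hρ'𝒰 hr' hΨ hΨch hΨρ' hmu hx
  -- Step 1: if one side has no barycentres, so has the other, and `r = r'`.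
  -- General tool: a side with a nonempty chain has a top `μ` with the point in `μ`, in no proper face.
  have top : ∀ {ρ₁ : PointedCone ℚ (κ → ℚ)} {r₁ : κ → ℚ} {Θ : Finset (PointedCone ℚ (κ → ℚ))}
      {nu : PointedCone ℚ (κ → ℚ) → ℚ}, ρ₁ ∈ Δ.cones → r₁ ∈ ρ₁ → (↑Θ ⊆ 𝒰) →
      IsChain (· ≤ ·) (Θ : Set (PointedCone ℚ (κ → ℚ))) → (∀ θ ∈ Θ, ρ₁ ≤ θ) → (∀ θ ∈ Θ, 0 < nu θ) →
      ∀ {μ}, Maximal (· ∈ Θ) μ →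
        (r₁ + ∑ θ ∈ Θ, nu θ • bary θ) ∈ μ ∧
          ∀ F : PointedCone ℚ (κ → ℚ), F.IsFaceOf μ → (r₁ + ∑ θ ∈ Θ, nu θ • bary θ) ∈ F → F = μ := by
    intro ρ₁ r₁ Θ nu hρ₁ hr₁ hΘ hΘch hΘρ hnu μ hμ
    have hμΘ : μ ∈ Θ := hμ.1
    have hμΔ : μ ∈ Δ.cones := h𝒰 (hΘ (Finset.mem_coe.mpr hμΘ))
    have hle : ∀ θ ∈ Θ, θ ≤ μ := fun θ hθ => le_of_maximal_of_isChain hΘch hμ hθ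
    -- split off the top term
    have hsplit : r₁ + ∑ θ ∈ Θ, nu θ • bary θ =
        nu μ • bary μ + (r₁ + ∑ θ ∈ Θ.erase μ, nu θ • bary θ) := by
      rw [← Finset.add_sum_erase Θ (fun θ => nu θ • bary θ) hμΘ]; abel
    have hy : r₁ + ∑ θ ∈ Θ.erase μ, nu θ • bary θ ∈ μ :=
      rep_mem_of_le hr₁ (hΘρ μ hμΘ) (fun θ hθ => h𝒰 (hΘ (Finset.mem_coe.mpr (Finset.mem_of_mem_erase hθ))))
        (fun θ hθ => hle θ (Finset.mem_of_mem_erase hθ))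
        (fun θ hθ => (hnu θ (Finset.mem_of_mem_erase hθ)).le)
    refine ⟨?_, fun F hF hxF => ?_⟩
    · rw [hsplit]
      exact μ.add_mem (smul_mem_of_nonneg (bary_mem (Δ.fg hμΔ)) (hnu μ hμΘ).le) hy
    · rw [hsplit] at hxF
      exact eq_of_isFaceOf_of_rep_mem hΔ hμΔ hy (hnu μ hμΘ) hF hxF
  -- a nonempty side forces the other side's base into `𝒰` unless the other side is nonempty too
  have base_case : ∀ {ρ₁ ρ₂ : PointedCone ℚ (κ → ℚ)} {r₂ : κ → ℚ} {x : κ → ℚ},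
      ρ₂ ∈ Δ.cones → ρ₂ ∉ 𝒰 → r₂ ∈ ρ₂ → x = r₂ →
      ∀ {μ}, μ ∈ 𝒰 → μ ∈ Δ.cones → x ∈ μ →
        (∀ F : PointedCone ℚ (κ → ℚ), F.IsFaceOf μ → x ∈ F → F = μ) → ρ₁ = ρ₁ → False := by
    intro ρ₁ ρ₂ r₂ x hρ₂ hρ₂𝒰 hr₂ hxr μ hμ𝒰 hμΔ hxμ hnf _
    -- `x ∈ ρ₂ ∩ μ`, a face of `μ`; it is all of `μ`, so `μ ≤ ρ₂ ∈ 𝒰`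
    have hface : (μ ⊓ ρ₂).IsFaceOf μ := Δ.inf_isFaceOf hμΔ hρ₂
    have heq := hnf _ hface (Submodule.mem_inf.mpr ⟨hxμ, hxr ▸ hr₂⟩)
    have hμρ₂ : μ ≤ ρ₂ := fun z hz => (Submodule.mem_inf.mp (heq.symm ▸ hz : z ∈ μ ⊓ ρ₂)).2
    exact hρ₂𝒰 (hup μ hμ𝒰 ρ₂ hρ₂ hμρ₂)
  rcases Φ.eq_empty_or_nonempty with hΦe | hΦne
  · -- `Φ = ∅`
    subst hΦe
    rcases Ψ.eq_empty_or_nonempty with hΨe | hΨne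
    · subst hΨe
      simp only [Finset.sum_empty, add_zero] at hx
      exact ⟨rfl, fun _ h => absurd h (Finset.notMem_empty _), hx⟩
    · exfalso
      obtain ⟨μ, hμ⟩ := Finset.exists_maximal hΨne
      obtain ⟨hxμ, hnf⟩ := top hρ' hr' hΨ hΨch hΨρ' hmu hμ
      simp only [Finset.sum_empty, add_zero] at hx
      exact base_case (ρ₁ := ρ) hρ hρ𝒰 hr hx.symm (hΨ (Finset.mem_coe.mpr hμ.1))
        (h𝒰 (hΨ (Finset.mem_coe.mpr hμ.1))) hxμ hnf rfl
  · obtain ⟨φs, hφs⟩ := Finset.exists_maximal hΦne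
    obtain ⟨hxφ, hnfφ⟩ := top hρ hr hΦ hΦch hΦρ hlam hφs
    have hφsΦ : φs ∈ Φ := hφs.1
    have hφs𝒰 : φs ∈ 𝒰 := hΦ (Finset.mem_coe.mpr hφsΦ)
    have hφsΔ : φs ∈ Δ.cones := h𝒰 hφs𝒰
    rcases Ψ.eq_empty_or_nonempty with hΨe | hΨne
    · exfalso
      subst hΨe
      simp only [Finset.sum_empty, add_zero] at hx
      exact base_case (ρ₁ := ρ') hρ' hρ'𝒰 hr' hx hφs𝒰 hφsΔ hxφ hnfφ rfl
    obtain ⟨ψs, hψs⟩ := Finset.exists_maximal hΨne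
    obtain ⟨hxψ, hnfψ⟩ := top hρ' hr' hΨ hΨch hΨρ' hmu hψs
    have hψsΨ : ψs ∈ Ψ := hψs.1
    have hψsΔ : ψs ∈ Δ.cones := h𝒰 (hΨ (Finset.mem_coe.mpr hψsΨ))
    rw [← hx] at hxψ hnfψ
    -- the two tops coincide
    have htops : φs = ψs := by
      have h1 : φs ≤ ψs := by
        have hface : (φs ⊓ ψs).IsFaceOf φs := Δ.inf_isFaceOf hφsΔ hψsΔ
        have heq := hnfφ _ hface (Submodule.mem_inf.mpr ⟨hxφ, hxψ⟩)
        exact fun z hz => (Submodule.mem_inf.mp (heq.symm ▸ hz : z ∈ φs ⊓ ψs)).2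
      have h2 : ψs ≤ φs := by
        have hface : (ψs ⊓ φs).IsFaceOf ψs := Δ.inf_isFaceOf hψsΔ hφsΔ
        have heq := hnfψ _ hface (Submodule.mem_inf.mpr ⟨hxψ, hxφ⟩)
        exact fun z hz => (Submodule.mem_inf.mp (heq.symm ▸ hz : z ∈ ψs ⊓ φs)).2
      exact le_antisymm h1 h2
    subst htops
    -- the two top coefficients coincide
    set y := r + ∑ φ ∈ Φ.erase φs, lam φ • bary φ with hy
    set y' := r' + ∑ ψ ∈ Ψ.erase φs, mu ψ • bary ψ with hy'
    have hsplit : r + ∑ φ ∈ Φ, lam φ • bary φ = lam φs • bary φs + y := by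
      rw [hy, ← Finset.add_sum_erase Φ (fun θ => lam θ • bary θ) hφsΦ]; abel
    have hsplit' : r' + ∑ ψ ∈ Ψ, mu ψ • bary ψ = mu φs • bary φs + y' := by
      rw [hy', ← Finset.add_sum_erase Ψ (fun θ => mu θ • bary θ) hψsΨ]; abel
    -- data of the peeled representations
    have hΦ' : (↑(Φ.erase φs) : Set (PointedCone ℚ (κ → ℚ))) ⊆ 𝒰 := fun θ hθ =>
      hΦ (Finset.mem_coe.mpr (Finset.mem_of_mem_erase (Finset.mem_coe.mp hθ)))
    have hΨ' : (↑(Ψ.erase φs) : Set (PointedCone ℚ (κ → ℚ))) ⊆ 𝒰 := fun θ hθ =>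
      hΨ (Finset.mem_coe.mpr (Finset.mem_of_mem_erase (Finset.mem_coe.mp hθ)))
    have hΦ'ch : IsChain (· ≤ ·) (↑(Φ.erase φs) : Set (PointedCone ℚ (κ → ℚ))) :=
      hΦch.mono (by rw [Finset.coe_erase]; exact fun z hz => hz.1)
    have hΨ'ch : IsChain (· ≤ ·) (↑(Ψ.erase φs) : Set (PointedCone ℚ (κ → ℚ))) :=
      hΨch.mono (by rw [Finset.coe_erase]; exact fun z hz => hz.1)
    -- the peeled points lie in a proper sub-cone of the top
    have peeled_mem : ∀ {ρ₁ : PointedCone ℚ (κ → ℚ)} {r₁ : κ → ℚ} {Θ : Finset (PointedCone ℚ (κ → ℚ))}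
        {nu : PointedCone ℚ (κ → ℚ) → ℚ}, ρ₁ ∈ Δ.cones → ρ₁ ∉ 𝒰 → r₁ ∈ ρ₁ → (↑Θ ⊆ 𝒰) →
        IsChain (· ≤ ·) (Θ : Set (PointedCone ℚ (κ → ℚ))) → (∀ θ ∈ Θ, ρ₁ ≤ θ) →
        (∀ θ ∈ Θ, 0 < nu θ) → φs ∈ Θ → (∀ θ ∈ Θ, θ ≤ φs) →
        ∃ C ∈ Δ.cones, C ≤ φs ∧ C ≠ φs ∧ (r₁ + ∑ θ ∈ Θ.erase φs, nu θ • bary θ) ∈ C := by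
      intro ρ₁ r₁ Θ nu hρ₁ hρ₁𝒰 hr₁ hΘ hΘch hΘρ hnu hφΘ hle
      rcases (Θ.erase φs).eq_empty_or_nonempty with he | hne
      · refine ⟨ρ₁, hρ₁, hΘρ φs hφΘ, fun h => hρ₁𝒰 (h ▸ hφs𝒰), ?_⟩
        rw [he, Finset.sum_empty, add_zero]; exact hr₁
      · obtain ⟨φ₂, hφ₂⟩ := Finset.exists_maximal hne
        have hφ₂Θ : φ₂ ∈ Θ := Finset.mem_of_mem_erase hφ₂.1
        have hΘ'ch : IsChain (· ≤ ·) (↑(Θ.erase φs) : Set (PointedCone ℚ (κ → ℚ))) :=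
          hΘch.mono (by rw [Finset.coe_erase]; exact fun z hz => hz.1)
        refine ⟨φ₂, h𝒰 (hΘ (Finset.mem_coe.mpr hφ₂Θ)), hle φ₂ hφ₂Θ, Finset.ne_of_mem_erase hφ₂.1, ?_⟩
        exact rep_mem_of_le hr₁ (hΘρ φ₂ hφ₂Θ)
          (fun θ hθ => h𝒰 (hΘ (Finset.mem_coe.mpr (Finset.mem_of_mem_erase hθ))))
          (fun θ hθ => le_of_maximal_of_isChain hΘ'ch hφ₂ hθ) (fun θ hθ => (hnu θ (Finset.mem_of_mem_erase hθ)).le)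
    have hleΦ : ∀ θ ∈ Φ, θ ≤ φs := fun θ hθ => le_of_maximal_of_isChain hΦch hφs hθ
    have hleΨ : ∀ θ ∈ Ψ, θ ≤ φs := fun θ hθ => le_of_maximal_of_isChain hΨch hψs hθ
    obtain ⟨C, hC, hCφ, hCne, hyC⟩ := peeled_mem hρ hρ𝒰 hr hΦ hΦch hΦρ hlam hφsΦ hleΦ
    obtain ⟨C', hC', hC'φ, hC'ne, hy'C⟩ := peeled_mem hρ' hρ'𝒰 hr' hΨ hΨch hΨρ' hmu hψsΨ hleΨ
    have hyφ : y ∈ φs := hCφ hyC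
    have hy'φ : y' ∈ φs := hC'φ hy'C
    have hcoef : lam φs = mu φs := by
      by_contra hne
      rcases lt_or_gt_of_ne hne with hlt | hlt
      · -- `y = (mu - lam) • bary φs + y'` has a positive top coefficient but lies in `C`
        have hyeq : y = (mu φs - lam φs) • bary φs + y' := by
          have := hx
          rw [hsplit, hsplit'] at this
          have : y = mu φs • bary φs + y' - lam φs • bary φs := by rw [← this]; abel
          rw [this, sub_smul]; abel
        have hnf : ∀ F : PointedCone ℚ (κ → ℚ), F.IsFaceOf φs → y ∈ F → F = φs := fun F hF hyF =>
          eq_of_isFaceOf_of_rep_mem hΔ hφsΔ hy'φ (sub_pos.mpr hlt) hF (hyeq ▸ hyF)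
        exact not_mem_of_forall_isFaceOf hφsΔ hC hCφ hCne hnf hyC
      · have hyeq : y' = (lam φs - mu φs) • bary φs + y := by
          have := hx
          rw [hsplit, hsplit'] at this
          have : y' = lam φs • bary φs + y - mu φs • bary φs := by rw [this]; abel
          rw [this, sub_smul]; abel
        have hnf : ∀ F : PointedCone ℚ (κ → ℚ), F.IsFaceOf φs → y' ∈ F → F = φs := fun F hF hyF =>
          eq_of_isFaceOf_of_rep_mem hΔ hφsΔ hyφ (sub_pos.mpr hlt) hF (hyeq ▸ hyF)
        exact not_mem_of_forall_isFaceOf hφsΔ hC' hC'φ hC'ne hnf hy'C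
    -- peel and apply the induction hypothesis
    have hyy : y = y' := by
      have := hx
      rw [hsplit, hsplit', hcoef] at this
      exact add_left_cancel this
    have hcard : (Φ.erase φs).card + (Ψ.erase φs).card < n := by
      have h1 := Finset.card_erase_lt_of_mem hφsΦ
      have h2 := Finset.card_erase_lt_of_mem hψsΨ
      omega
    obtain ⟨hΦΨ, hcoefs, hrr⟩ := ih _ hcard le_rfl hρ hρ𝒰 hr hΦ' hΦ'ch
      (fun θ hθ => hΦρ θ (Finset.mem_of_mem_erase hθ)) (fun θ hθ => hlam θ (Finset.mem_of_mem_erase hθ))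
      hρ' hρ'𝒰 hr' hΨ' hΨ'ch (fun θ hθ => hΨρ' θ (Finset.mem_of_mem_erase hθ))
      (fun θ hθ => hmu θ (Finset.mem_of_mem_erase hθ)) hyy
    refine ⟨?_, fun θ hθ => ?_, hrr⟩
    · rw [← Finset.insert_erase hφsΦ, ← Finset.insert_erase hψsΨ, hΦΨ]
    · by_cases hθs : θ = φs
      · rw [hθs]; exact hcoef
      · exact hcoefs θ (Finset.mem_erase.mpr ⟨hθs, hθ⟩)

/-! ## Stage cones -/

/-- The **stage cones** of the barycentric subdivision of `Δ` after starring the cones of the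
(upward closed) set `𝒰`: the joins `ρ + flagCone Φ` of an unstarred cone `ρ ∈ Δ ∖ 𝒰` with the
flag cone of a chain `Φ ⊆ 𝒰` of starred cones above `ρ` ([KempfEtAl1973] II §2: the cells of
the partially performed barycentric subdivision). [cite: KempfEtAl1973, II §2] -/
def stageCones (Δ : Fan ℚ (κ → ℚ)) (𝒰 : Set (PointedCone ℚ (κ → ℚ))) :
    Set (PointedCone ℚ (κ → ℚ)) :=
  {σ | ∃ ρ ∈ Δ.cones, ρ ∉ 𝒰 ∧ ∃ Φ : Finset (PointedCone ℚ (κ → ℚ)),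
    (↑Φ ⊆ 𝒰) ∧ IsChain (· ≤ ·) (Φ : Set (PointedCone ℚ (κ → ℚ))) ∧ (∀ φ ∈ Φ, ρ ≤ φ) ∧
      σ = ρ ⊔ flagCone (Φ : Set (PointedCone ℚ (κ → ℚ)))}

/-- Membership in the stage cones, unfolded. [cite: KempfEtAl1973, II §2] -/
theorem mem_stageCones_iff {𝒰 : Set (PointedCone ℚ (κ → ℚ))} {σ : PointedCone ℚ (κ → ℚ)} :
    σ ∈ Δ.stageCones 𝒰 ↔ ∃ ρ ∈ Δ.cones, ρ ∉ 𝒰 ∧ ∃ Φ : Finset (PointedCone ℚ (κ → ℚ)),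
      (↑Φ ⊆ 𝒰) ∧ IsChain (· ≤ ·) (Φ : Set (PointedCone ℚ (κ → ℚ))) ∧ (∀ φ ∈ Φ, ρ ≤ φ) ∧
        σ = ρ ⊔ flagCone (Φ : Set (PointedCone ℚ (κ → ℚ))) := Iff.rfl

/-- Before any star (`𝒰 = ∅`) the stage cones are the cones of `Δ`. [cite: KempfEtAl1973, II §2] -/
theorem stageCones_empty : Δ.stageCones ∅ = Δ.cones := by
  ext σ
  rw [mem_stageCones_iff]
  constructor
  · rintro ⟨ρ, hρ, -, Φ, hΦ, -, -, rfl⟩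
    have hΦe : Φ = ∅ := Finset.eq_empty_of_forall_notMem fun φ hφ => hΦ (Finset.mem_coe.mpr hφ)
    rw [hΦe, Finset.coe_empty, flagCone_empty, sup_bot_eq]
    exact hρ
  · intro hσ
    refine ⟨σ, hσ, fun h => h, ∅, by simp, by simp [IsChain], by simp, ?_⟩
    rw [Finset.coe_empty, flagCone_empty, sup_bot_eq]

/-- If an upward closed `𝒰 ⊆ Δ` misses some cone `ρ`, it misses `⊥`. [cite: KempfEtAl1973, II §2] -/
theorem bot_not_mem_of_not_mem {𝒰 : Set (PointedCone ℚ (κ → ℚ))}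
    (hup : ∀ φ ∈ 𝒰, ∀ ψ ∈ Δ.cones, φ ≤ ψ → ψ ∈ 𝒰) {ρ : PointedCone ℚ (κ → ℚ)} (hρ : ρ ∈ Δ.cones)
    (hρ𝒰 : ρ ∉ 𝒰) : (⊥ : PointedCone ℚ (κ → ℚ)) ∉ 𝒰 := fun h => hρ𝒰 (hup ⊥ h ρ hρ bot_le)

/-- A point of the join `ρ + flagCone Φ` is `r + Σ_{φ ∈ Φ} μ_φ b_φ` with `r ∈ ρ`, `μ ≥ 0`.
[cite: KempfEtAl1973, II §2] -/
theorem exists_rep_of_mem_sup_flagCone (hΔ : Δ.IsRational) {ρ : PointedCone ℚ (κ → ℚ)}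
    {Φ : Finset (PointedCone ℚ (κ → ℚ))} (hΦ : (↑Φ : Set (PointedCone ℚ (κ → ℚ))) ⊆ Δ.cones)
    {x : κ → ℚ} (hx : x ∈ ρ ⊔ flagCone (Φ : Set (PointedCone ℚ (κ → ℚ)))) :
    ∃ r ∈ ρ, ∃ mu : PointedCone ℚ (κ → ℚ) → ℚ, (∀ φ ∈ Φ, 0 ≤ mu φ) ∧
      x = r + ∑ φ ∈ Φ, mu φ • bary φ := by
  classical
  obtain ⟨r, hr, f, hf, rfl⟩ := Submodule.mem_sup.mp hx
  rw [flagCone_coe] at hf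
  obtain ⟨c, hc, hcf⟩ := mem_hull_finset_iff.mp hf
  refine ⟨r, hr, fun φ => c (bary φ), fun φ hφ => hc _ (Finset.mem_image_of_mem _ hφ), ?_⟩
  rw [← hcf, Finset.sum_image fun φ hφ ψ hψ h => bary_injOn hΔ (hΦ (Finset.mem_coe.mpr hφ))
    (hΦ (Finset.mem_coe.mpr hψ)) h]

/-- Discarding the zero coefficients of a representation. [cite: KempfEtAl1973, II §2] -/
theorem sum_filter_pos_eq {Φ : Finset (PointedCone ℚ (κ → ℚ))} {mu : PointedCone ℚ (κ → ℚ) → ℚ}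
    (hmu : ∀ φ ∈ Φ, 0 ≤ mu φ) :
    ∑ φ ∈ Φ.filter (fun φ => 0 < mu φ), mu φ • bary φ = ∑ φ ∈ Φ, mu φ • bary φ := by
  classical
  rw [Finset.sum_filter]
  refine Finset.sum_congr rfl fun φ hφ => ?_
  split_ifs with h
  · rfl
  · have : mu φ = 0 := le_antisymm (not_lt.mp h) (hmu φ hφ)
    rw [this, zero_smul]

/-- **Barycentres of unstarred cones**: if `bary φ₀` (`φ₀ ∈ Δ ∖ 𝒰`) lies in the stage cone
`ρ + flagCone Φ`, then `φ₀ ≤ ρ`. [cite: KempfEtAl1973, II §2] -/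
theorem le_of_bary_mem_stageCone (hΔ : Δ.IsRational) {𝒰 : Set (PointedCone ℚ (κ → ℚ))}
    (h𝒰 : 𝒰 ⊆ Δ.cones) (hup : ∀ φ ∈ 𝒰, ∀ ψ ∈ Δ.cones, φ ≤ ψ → ψ ∈ 𝒰)
    {φ₀ : PointedCone ℚ (κ → ℚ)} (hφ₀ : φ₀ ∈ Δ.cones) (hφ₀𝒰 : φ₀ ∉ 𝒰)
    {ρ : PointedCone ℚ (κ → ℚ)} (hρ : ρ ∈ Δ.cones) (hρ𝒰 : ρ ∉ 𝒰)
    {Φ : Finset (PointedCone ℚ (κ → ℚ))} (hΦ : (↑Φ : Set (PointedCone ℚ (κ → ℚ))) ⊆ 𝒰)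
    (hΦch : IsChain (· ≤ ·) (Φ : Set (PointedCone ℚ (κ → ℚ)))) (hΦρ : ∀ φ ∈ Φ, ρ ≤ φ)
    (hb : bary φ₀ ∈ ρ ⊔ flagCone (Φ : Set (PointedCone ℚ (κ → ℚ)))) : φ₀ ≤ ρ := by
  classical
  obtain ⟨r, hr, mu, hmu, hx⟩ := exists_rep_of_mem_sup_flagCone hΔ (fun φ hφ => h𝒰 (hΦ hφ)) hb
  set Ψ := Φ.filter (fun φ => 0 < mu φ) with hΨ
  have hΨΦ : Ψ ⊆ Φ := Finset.filter_subset _ _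
  have hx' : bary φ₀ + ∑ φ ∈ (∅ : Finset (PointedCone ℚ (κ → ℚ))), (fun _ => (1 : ℚ)) φ • bary φ =
      r + ∑ ψ ∈ Ψ, mu ψ • bary ψ := by
    rw [Finset.sum_empty, add_zero, hΨ, sum_filter_pos_eq hmu]; exact hx
  obtain ⟨-, -, hrr⟩ := stageRep_unique hΔ h𝒰 hup _ le_rfl hφ₀ hφ₀𝒰 (bary_mem (Δ.fg hφ₀))
    (by simp) (by simp [IsChain]) (by simp) (by simp) hρ hρ𝒰 hr
    (fun ψ hψ => hΦ (Finset.mem_coe.mpr (hΨΦ (Finset.mem_coe.mp hψ))))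
    (hΦch.mono fun ψ hψ => Finset.mem_coe.mpr (hΨΦ (Finset.mem_coe.mp hψ)))
    (fun ψ hψ => hΦρ ψ (hΨΦ hψ)) (fun ψ hψ => (Finset.mem_filter.mp hψ).2) hx'
  exact (bary_mem_iff hΔ hφ₀ hρ).mp (hrr ▸ hr)

/-- **Barycentres of starred cones**: if `bary φ` (`φ ∈ 𝒰`) lies in the stage cone
`ρ + flagCone Φ`, then `φ ∈ Φ` (pv-2's "membership / uniqueness"). [cite: KempfEtAl1973, II §2] -/
theorem mem_chain_of_bary_mem_stageCone (hΔ : Δ.IsRational) {𝒰 : Set (PointedCone ℚ (κ → ℚ))}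
    (h𝒰 : 𝒰 ⊆ Δ.cones) (hup : ∀ φ ∈ 𝒰, ∀ ψ ∈ Δ.cones, φ ≤ ψ → ψ ∈ 𝒰)
    {φ₁ : PointedCone ℚ (κ → ℚ)} (hφ₁ : φ₁ ∈ 𝒰)
    {ρ : PointedCone ℚ (κ → ℚ)} (hρ : ρ ∈ Δ.cones) (hρ𝒰 : ρ ∉ 𝒰)
    {Φ : Finset (PointedCone ℚ (κ → ℚ))} (hΦ : (↑Φ : Set (PointedCone ℚ (κ → ℚ))) ⊆ 𝒰)
    (hΦch : IsChain (· ≤ ·) (Φ : Set (PointedCone ℚ (κ → ℚ)))) (hΦρ : ∀ φ ∈ Φ, ρ ≤ φ)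
    (hb : bary φ₁ ∈ ρ ⊔ flagCone (Φ : Set (PointedCone ℚ (κ → ℚ)))) : φ₁ ∈ Φ := by
  classical
  obtain ⟨r, hr, mu, hmu, hx⟩ := exists_rep_of_mem_sup_flagCone hΔ (fun φ hφ => h𝒰 (hΦ hφ)) hb
  set Ψ := Φ.filter (fun φ => 0 < mu φ) with hΨ
  have hΨΦ : Ψ ⊆ Φ := Finset.filter_subset _ _
  have hbot : (⊥ : PointedCone ℚ (κ → ℚ)) ∉ 𝒰 := bot_not_mem_of_not_mem hup hρ hρ𝒰
  have hx' : (0 : κ → ℚ) + ∑ φ ∈ ({φ₁} : Finset (PointedCone ℚ (κ → ℚ))), (fun _ => (1 : ℚ)) φ • bary φ =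
      r + ∑ ψ ∈ Ψ, mu ψ • bary ψ := by
    rw [Finset.sum_singleton, one_smul, zero_add, hΨ, sum_filter_pos_eq hmu]; exact hx
  obtain ⟨hΦΨ, -, -⟩ := stageRep_unique hΔ h𝒰 hup _ le_rfl (Δ.bot_mem hρ) hbot
    (Submodule.zero_mem _) (by simpa using hφ₁) (by simp [IsChain]) (by simp) (by simp) hρ hρ𝒰 hr
    (fun ψ hψ => hΦ (Finset.mem_coe.mpr (hΨΦ (Finset.mem_coe.mp hψ))))
    (hΦch.mono fun ψ hψ => Finset.mem_coe.mpr (hΨΦ (Finset.mem_coe.mp hψ)))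
    (fun ψ hψ => hΦρ ψ (hΨΦ hψ)) (fun ψ hψ => (Finset.mem_filter.mp hψ).2) hx'
  exact hΨΦ (hΦΨ ▸ Finset.mem_singleton_self φ₁)

/-- Adjoining the barycentre of `φ₀` to a flag cone. [cite: KempfEtAl1973, II §2] -/
theorem flagCone_insert [DecidableEq (PointedCone ℚ (κ → ℚ))] (φ₀ : PointedCone ℚ (κ → ℚ))
    (Φ : Finset (PointedCone ℚ (κ → ℚ))) :
    flagCone (↑(insert φ₀ Φ) : Set (PointedCone ℚ (κ → ℚ))) =
      flagCone (Φ : Set (PointedCone ℚ (κ → ℚ))) ⊔ ray ℚ (bary φ₀) := by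
  rw [flagCone, flagCone, Finset.coe_insert, Set.image_insert_eq, hull_insert]

/-! ## One barycentric star -/

/-- **One star of the barycentric subdivision.** If the fan `Γ` has exactly the stage cones of
the upward closed `𝒰`, and `φ₀ ∈ Δ ∖ 𝒰` is a nonzero cone all of whose proper super-cones are
already starred, then the star subdivision of `Γ` through `bary φ₀` has exactly the stage cones of
`𝒰 ∪ {φ₀}` ([KempfEtAl1973] II §2; [Ewald1996] III §2). [cite: KempfEtAl1973, II §2] -/
theorem starSubdivision_stageCones (hΔ : Δ.IsRational) {𝒰 : Set (PointedCone ℚ (κ → ℚ))}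
    (h𝒰 : 𝒰 ⊆ Δ.cones) (hup : ∀ φ ∈ 𝒰, ∀ ψ ∈ Δ.cones, φ ≤ ψ → ψ ∈ 𝒰)
    {Γ : Fan ℚ (κ → ℚ)} (hΓ : Γ.cones = Δ.stageCones 𝒰)
    {φ₀ : PointedCone ℚ (κ → ℚ)} (hφ₀ : φ₀ ∈ Δ.cones) (hφ₀𝒰 : φ₀ ∉ 𝒰)
    (hmax : ∀ ψ ∈ Δ.cones, φ₀ ≤ ψ → ψ ≠ φ₀ → ψ ∈ 𝒰) :
    (Γ.starSubdivision (bary φ₀)).cones = Δ.stageCones (insert φ₀ 𝒰) := by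
  classical
  set v := bary φ₀ with hv
  -- a stage cone contains `v` iff its base is `φ₀`
  have hvmem : ∀ {ρ : PointedCone ℚ (κ → ℚ)} (hρ : ρ ∈ Δ.cones) (hρ𝒰 : ρ ∉ 𝒰)
      {Φ : Finset (PointedCone ℚ (κ → ℚ))} (hΦ : (↑Φ : Set (PointedCone ℚ (κ → ℚ))) ⊆ 𝒰)
      (hΦch : IsChain (· ≤ ·) (↑Φ : Set (PointedCone ℚ (κ → ℚ))))
      (hΦρ : ∀ φ ∈ Φ, ρ ≤ φ), v ∈ ρ ⊔ flagCone (Φ : Set (PointedCone ℚ (κ → ℚ))) → ρ = φ₀ := by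
    intro ρ hρ hρ𝒰 Φ hΦ hΦch hΦρ hvσ
    have hle : φ₀ ≤ ρ := le_of_bary_mem_stageCone hΔ h𝒰 hup hφ₀ hφ₀𝒰 hρ hρ𝒰 hΦ hΦch hΦρ hvσ
    by_contra hne
    exact hρ𝒰 (hmax ρ hρ hle hne)
  ext σ'
  rw [starSubdivision_cones, mem_starCones_iff, mem_stageCones_iff]
  constructor
  · rintro (⟨hσ', hvσ'⟩ | ⟨τ, hτ, hvτ, ⟨σ, hσ, hτσ, hvσ⟩, rfl⟩)
    · -- an old cone not containing `v`
      rw [hΓ, mem_stageCones_iff] at hσ'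
      obtain ⟨ρ, hρ, hρ𝒰, Φ, hΦ, hΦch, hΦρ, rfl⟩ := hσ'
      have hne : ρ ≠ φ₀ := by
        rintro rfl
        exact hvσ' (Submodule.mem_sup_left (bary_mem (Δ.fg hρ)))
      refine ⟨ρ, hρ, ?_, Φ, fun φ hφ => Set.mem_insert_of_mem _ (hΦ hφ), hΦch, hΦρ, rfl⟩
      rintro (h | h)
      · exact hne h
      · exact hρ𝒰 h
    · -- a new cone `τ + ray v`
      rw [hΓ, mem_stageCones_iff] at hτ hσ
      obtain ⟨ρσ, hρσ, hρσ𝒰, Φσ, hΦσ, hΦσch, hΦσρ, rfl⟩ := hσ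
      obtain ⟨ρτ, hρτ, hρτ𝒰, Φτ, hΦτ, hΦτch, hΦτρ, rfl⟩ := hτ
      have hρσφ : ρσ = φ₀ := hvmem hρσ hρσ𝒰 hΦσ hΦσch hΦσρ hvσ
      subst hρσφ
      -- `ρτ ≤ φ₀`, `ρτ ≠ φ₀`, `Φτ ⊆ Φσ`
      have hρτle : ρτ ≤ ρσ :=
        le_of_bary_mem_stageCone hΔ h𝒰 hup hρτ hρτ𝒰 hρσ hρσ𝒰 hΦσ hΦσch hΦσρ
          (hτσ (Submodule.mem_sup_left (bary_mem (Δ.fg hρτ))))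
      have hρτne : ρτ ≠ ρσ := by
        rintro rfl
        exact hvτ (Submodule.mem_sup_left (bary_mem (Δ.fg hρτ)))
      have hΦτσ : Φτ ⊆ Φσ := fun φ hφ =>
        mem_chain_of_bary_mem_stageCone hΔ h𝒰 hup (hΦτ (Finset.mem_coe.mpr hφ)) hρσ hρσ𝒰 hΦσ hΦσch
          hΦσρ (hτσ (Submodule.mem_sup_right (bary_mem_flagCone (Finset.mem_coe.mpr hφ))))
      refine ⟨ρτ, hρτ, ?_, insert ρσ Φτ, ?_, ?_, ?_, ?_⟩
      · rintro (h | h)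
        · exact hρτne h
        · exact hρτ𝒰 h
      · intro φ hφ
        rcases Finset.mem_insert.mp (Finset.mem_coe.mp hφ) with rfl | hφ
        · exact Set.mem_insert _ _
        · exact Set.mem_insert_of_mem _ (hΦτ (Finset.mem_coe.mpr hφ))
      · -- chain: `φ₀ ≤ every member of Φτ ⊆ Φσ`
        intro a ha b hb hab
        rcases Finset.mem_insert.mp (Finset.mem_coe.mp ha) with rfl | ha'
        · rcases Finset.mem_insert.mp (Finset.mem_coe.mp hb) with rfl | hb'
          · exact absurd rfl hab
          · exact Or.inl (hΦσρ b (hΦτσ hb'))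
        · rcases Finset.mem_insert.mp (Finset.mem_coe.mp hb) with rfl | hb'
          · exact Or.inr (hΦσρ a (hΦτσ ha'))
          · exact hΦτch (Finset.mem_coe.mpr ha') (Finset.mem_coe.mpr hb') hab
      · intro φ hφ
        rcases Finset.mem_insert.mp hφ with rfl | hφ
        · exact hρτle
        · exact hΦτρ φ hφ
      · rw [flagCone_insert, ← sup_assoc]
  · rintro ⟨ρ, hρ, hρU, Ψ, hΨ, hΨch, hΨρ, rfl⟩
    have hρne : ρ ≠ φ₀ := fun h => hρU (h ▸ Set.mem_insert _ _)
    have hρ𝒰 : ρ ∉ 𝒰 := fun h => hρU (Set.mem_insert_of_mem _ h)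
    by_cases hφΨ : φ₀ ∈ Ψ
    · -- `φ₀ ∈ Ψ`: a new cone
      right
      set Ψ' := Ψ.erase φ₀ with hΨ'
      have hΨ'𝒰 : (↑Ψ' : Set (PointedCone ℚ (κ → ℚ))) ⊆ 𝒰 := by
        intro ψ hψ
        have hψΨ : ψ ∈ Ψ := Finset.mem_of_mem_erase (Finset.mem_coe.mp hψ)
        rcases hΨ (Finset.mem_coe.mpr hψΨ) with h | h
        · exact absurd h (Finset.ne_of_mem_erase (Finset.mem_coe.mp hψ))
        · exact h
      have hΨ'ch : IsChain (· ≤ ·) (↑Ψ' : Set (PointedCone ℚ (κ → ℚ))) :=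
        hΨch.mono (by rw [hΨ', Finset.coe_erase]; exact fun z hz => hz.1)
      -- members of `Ψ'` are above `φ₀` (they are comparable with it and lie in `𝒰`)
      have hΨ'φ : ∀ ψ ∈ Ψ', φ₀ ≤ ψ := by
        intro ψ hψ
        have hψΨ : ψ ∈ Ψ := Finset.mem_of_mem_erase hψ
        have hne : ψ ≠ φ₀ := Finset.ne_of_mem_erase hψ
        rcases hΨch (Finset.mem_coe.mpr hψΨ) (Finset.mem_coe.mpr hφΨ) hne with h | h
        · exact absurd (hup ψ (hΨ'𝒰 (Finset.mem_coe.mpr hψ)) φ₀ hφ₀ h) hφ₀𝒰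
        · exact h
      have hρφ : ρ ≤ φ₀ := hΨρ φ₀ hφΨ
      refine ⟨ρ ⊔ flagCone (↑Ψ' : Set (PointedCone ℚ (κ → ℚ))), ?_, ?_,
        ⟨φ₀ ⊔ flagCone (↑Ψ' : Set (PointedCone ℚ (κ → ℚ))), ?_, ?_, ?_⟩, ?_⟩
      · rw [hΓ, mem_stageCones_iff]
        exact ⟨ρ, hρ, hρ𝒰, Ψ', hΨ'𝒰, hΨ'ch, fun ψ hψ => hΨρ ψ (Finset.mem_of_mem_erase hψ), rfl⟩
      · intro hvτ
        exact hρne (hvmem hρ hρ𝒰 hΨ'𝒰 hΨ'ch (fun ψ hψ => hΨρ ψ (Finset.mem_of_mem_erase hψ)) hvτ)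
      · rw [hΓ, mem_stageCones_iff]
        exact ⟨φ₀, hφ₀, hφ₀𝒰, Ψ', hΨ'𝒰, hΨ'ch, hΨ'φ, rfl⟩
      · exact sup_le_sup_right hρφ _
      · exact Submodule.mem_sup_left (bary_mem (Δ.fg hφ₀))
      · rw [sup_assoc, hv, ← flagCone_insert, hΨ', Finset.insert_erase hφΨ]
    · -- `φ₀ ∉ Ψ`: an old cone not containing `v`
      left
      have hΨ𝒰 : (↑Ψ : Set (PointedCone ℚ (κ → ℚ))) ⊆ 𝒰 := by
        intro ψ hψ
        rcases hΨ hψ with h | h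
        · exact absurd (h ▸ Finset.mem_coe.mp hψ) hφΨ
        · exact h
      refine ⟨?_, fun hvσ => hρne (hvmem hρ hρ𝒰 hΨ𝒰 hΨch hΨρ hvσ)⟩
      rw [hΓ, mem_stageCones_iff]
      exact ⟨ρ, hρ, hρ𝒰, Ψ, hΨ𝒰, hΨch, hΨρ, rfl⟩

/-- **Stage separation.** If `Γ` has exactly the stage cones of `𝒰`, and `φ₀, φ₀'` are unstarred
cones all of whose proper super-cones are starred, then a cone of `Γ` containing both barycentres
forces `φ₀ = φ₀'` — the barycentres of a batch are SEPARATED, as required by the multi-point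
Lemma 2 (`IsOrdFunction.multiStar`). [cite: KempfEtAl1973, II §2] -/
theorem stage_separated (hΔ : Δ.IsRational) {𝒰 : Set (PointedCone ℚ (κ → ℚ))}
    (h𝒰 : 𝒰 ⊆ Δ.cones) (hup : ∀ φ ∈ 𝒰, ∀ ψ ∈ Δ.cones, φ ≤ ψ → ψ ∈ 𝒰)
    {Γ : Fan ℚ (κ → ℚ)} (hΓ : Γ.cones = Δ.stageCones 𝒰)
    {φ₀ φ₀' : PointedCone ℚ (κ → ℚ)} (hφ₀ : φ₀ ∈ Δ.cones) (hφ₀𝒰 : φ₀ ∉ 𝒰)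
    (hmax : ∀ ψ ∈ Δ.cones, φ₀ ≤ ψ → ψ ≠ φ₀ → ψ ∈ 𝒰)
    (hφ₀' : φ₀' ∈ Δ.cones) (hφ₀'𝒰 : φ₀' ∉ 𝒰)
    (hmax' : ∀ ψ ∈ Δ.cones, φ₀' ≤ ψ → ψ ≠ φ₀' → ψ ∈ 𝒰)
    {σ : PointedCone ℚ (κ → ℚ)} (hσ : σ ∈ Γ.cones) (hb : bary φ₀ ∈ σ) (hb' : bary φ₀' ∈ σ) :
    φ₀ = φ₀' := by
  rw [hΓ, mem_stageCones_iff] at hσ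
  obtain ⟨ρ, hρ, hρ𝒰, Φ, hΦ, hΦch, hΦρ, rfl⟩ := hσ
  have h1 : φ₀ ≤ ρ := le_of_bary_mem_stageCone hΔ h𝒰 hup hφ₀ hφ₀𝒰 hρ hρ𝒰 hΦ hΦch hΦρ hb
  have h2 : φ₀' ≤ ρ := le_of_bary_mem_stageCone hΔ h𝒰 hup hφ₀' hφ₀'𝒰 hρ hρ𝒰 hΦ hΦch hΦρ hb'
  have e1 : ρ = φ₀ := by by_contra hne; exact hρ𝒰 (hmax ρ hρ h1 hne)
  have e2 : ρ = φ₀' := by by_contra hne; exact hρ𝒰 (hmax' ρ hρ h2 hne)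
  exact e1.symm.trans e2

/-- **A batch of barycentric stars.** If `Γ` has exactly the stage cones of `𝒰` and `L` is a
duplicate-free list of nonzero unstarred cones all of whose proper super-cones are starred, then
the iterated star subdivision of `Γ` through their barycentres (in the order of `L` — in any
order, by `starIter_cones_eq_of_separated` and `stage_separated`) has exactly the stage cones of
`𝒰 ∪ L`. [cite: KempfEtAl1973, II §2] -/
theorem starIter_stageCones (hΔ : Δ.IsRational) :
    ∀ (L : List (PointedCone ℚ (κ → ℚ))) {𝒰 : Set (PointedCone ℚ (κ → ℚ))} {Γ : Fan ℚ (κ → ℚ)},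
      𝒰 ⊆ Δ.cones → (∀ φ ∈ 𝒰, ∀ ψ ∈ Δ.cones, φ ≤ ψ → ψ ∈ 𝒰) → Γ.cones = Δ.stageCones 𝒰 →
      L.Nodup → (∀ φ ∈ L, φ ∈ Δ.cones ∧ φ ∉ 𝒰 ∧ ∀ ψ ∈ Δ.cones, φ ≤ ψ → ψ ≠ φ → ψ ∈ 𝒰) →
      (Γ.starIter (L.map bary)).cones = Δ.stageCones (𝒰 ∪ {φ | φ ∈ L})
  | [], 𝒰, Γ, _, _, hΓ, _, _ => by
    rw [List.map_nil, starIter_nil, hΓ]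
    congr 1
    ext φ; simp
  | φ₀ :: L, 𝒰, Γ, h𝒰, hup, hΓ, hnd, hL => by
    classical
    have hφ₀L : φ₀ ∉ L := (List.nodup_cons.mp hnd).1
    obtain ⟨hφ₀, hφ₀𝒰, hmax⟩ := hL φ₀ List.mem_cons_self
    have hstep := starSubdivision_stageCones hΔ h𝒰 hup hΓ hφ₀ hφ₀𝒰 hmax
    -- the enlarged starred set is again upward closed
    have h𝒰' : insert φ₀ 𝒰 ⊆ Δ.cones := Set.insert_subset hφ₀ h𝒰
    have hup' : ∀ φ ∈ insert φ₀ 𝒰, ∀ ψ ∈ Δ.cones, φ ≤ ψ → ψ ∈ insert φ₀ 𝒰 := by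
      rintro φ (rfl | hφ) ψ hψ hle
      · by_cases h : ψ = φ
        · exact h ▸ Set.mem_insert _ _
        · exact Set.mem_insert_of_mem _ (hmax ψ hψ hle h)
      · exact Set.mem_insert_of_mem _ (hup φ hφ ψ hψ hle)
    have hL' : ∀ φ ∈ L, φ ∈ Δ.cones ∧ φ ∉ insert φ₀ 𝒰 ∧
        ∀ ψ ∈ Δ.cones, φ ≤ ψ → ψ ≠ φ → ψ ∈ insert φ₀ 𝒰 := by
      intro φ hφ
      obtain ⟨hφΔ, hφ𝒰, hφmax⟩ := hL φ (List.mem_cons_of_mem φ₀ hφ)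
      refine ⟨hφΔ, ?_, fun ψ hψ hle hne => Set.mem_insert_of_mem _ (hφmax ψ hψ hle hne)⟩
      rintro (h | h)
      · exact hφ₀L (h ▸ hφ)
      · exact hφ𝒰 h
    rw [List.map_cons, starIter_cons,
      starIter_stageCones hΔ L h𝒰' hup' hstep (List.nodup_cons.mp hnd).2 hL']
    congr 1
    ext φ
    simp only [Set.mem_union, Set.mem_insert_iff, Set.mem_setOf_eq, List.mem_cons]
    tauto

/-! ## Dimension packaging: the batches `B_d` -/

section Dim

variable [Fintype κ]

/-- The starred set "all cones of dimension `> d`" is contained in `Δ` and upward closed.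
[cite: KempfEtAl1973, II §2] -/
theorem upward_dimGt (d : ℕ) :
    {φ | φ ∈ Δ.cones ∧ d < Module.finrank ℚ (Submodule.span ℚ (φ : Set (κ → ℚ)))} ⊆ Δ.cones ∧
    ∀ φ ∈ {φ | φ ∈ Δ.cones ∧ d < Module.finrank ℚ (Submodule.span ℚ (φ : Set (κ → ℚ)))},
      ∀ ψ ∈ Δ.cones, φ ≤ ψ →
        ψ ∈ {φ | φ ∈ Δ.cones ∧ d < Module.finrank ℚ (Submodule.span ℚ (φ : Set (κ → ℚ)))} := by
  refine ⟨fun φ hφ => hφ.1, fun φ hφ ψ hψ hle => ⟨hψ, lt_of_lt_of_le hφ.2 ?_⟩⟩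
  exact Submodule.finrank_mono (Submodule.span_mono hle)

/-- A cone of dimension exactly `d` is unstarred at stage `d` and all its proper super-cones are
starred (they have larger dimension). [cite: KempfEtAl1973, II §2] -/
theorem batch_dimEq {d : ℕ} {φ : PointedCone ℚ (κ → ℚ)} (hφ : φ ∈ Δ.cones)
    (hd : Module.finrank ℚ (Submodule.span ℚ (φ : Set (κ → ℚ))) = d) :
    φ ∈ Δ.cones ∧ φ ∉ {φ | φ ∈ Δ.cones ∧ d < Module.finrank ℚ (Submodule.span ℚ (φ : Set (κ → ℚ)))} ∧
      ∀ ψ ∈ Δ.cones, φ ≤ ψ → ψ ≠ φ →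
        ψ ∈ {φ | φ ∈ Δ.cones ∧ d < Module.finrank ℚ (Submodule.span ℚ (φ : Set (κ → ℚ)))} := by
  refine ⟨hφ, fun h => ?_, fun ψ hψ hle hne => ⟨hψ, ?_⟩⟩
  · exact absurd hd (ne_of_gt h.2)
  · rw [← hd]
    exact finrank_span_lt_of_isFaceOf_ne (Δ.isFaceOf_of_le hψ hφ hle) (Ne.symm hne)

/-- **Stage `d−1` from stage `d`** ([KempfEtAl1973] II §2: star the `d`-dimensional cells after
all higher-dimensional ones): if `Γ` has the stage cones of "dimension `> d`" and `L` lists the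
`d`-dimensional cones of `Δ` (no duplicates, `1 ≤ d`), then `Γ.starIter (L.map bary)` has the
stage cones of "dimension `> d − 1`". [cite: KempfEtAl1973, II §2] -/
theorem starIter_dimStage (hΔ : Δ.IsRational) {d : ℕ} (hd : 1 ≤ d) {Γ : Fan ℚ (κ → ℚ)}
    (hΓ : Γ.cones = Δ.stageCones
      {φ | φ ∈ Δ.cones ∧ d < Module.finrank ℚ (Submodule.span ℚ (φ : Set (κ → ℚ)))})
    {L : List (PointedCone ℚ (κ → ℚ))} (hnd : L.Nodup)
    (hL : ∀ φ, φ ∈ L ↔ φ ∈ Δ.cones ∧ Module.finrank ℚ (Submodule.span ℚ (φ : Set (κ → ℚ))) = d) :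
    (Γ.starIter (L.map bary)).cones = Δ.stageCones
      {φ | φ ∈ Δ.cones ∧ d - 1 < Module.finrank ℚ (Submodule.span ℚ (φ : Set (κ → ℚ)))} := by
  obtain ⟨h𝒰, hup⟩ := upward_dimGt (Δ := Δ) d
  rw [starIter_stageCones hΔ L h𝒰 hup hΓ hnd fun φ hφ => batch_dimEq ((hL φ).1 hφ).1 ((hL φ).1 hφ).2]
  congr 1
  ext φ
  simp only [Set.mem_union, Set.mem_setOf_eq, hL]
  constructor
  · rintro (⟨hφ, hlt⟩ | ⟨hφ, heq⟩)
    · exact ⟨hφ, by omega⟩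
    · exact ⟨hφ, by omega⟩
  · rintro ⟨hφ, hlt⟩
    by_cases h : Module.finrank ℚ (Submodule.span ℚ (φ : Set (κ → ℚ))) = d
    · exact Or.inr ⟨hφ, h⟩
    · exact Or.inl ⟨hφ, by omega⟩

/-- **Separation of the batch `B_d`** in the stage fan of "dimension `> d`": a cone containing the
barycentres of two `d`-dimensional cones of `Δ` forces them to be equal (pv-2's (a)).
[cite: KempfEtAl1973, II §2] -/
theorem dimStage_separated (hΔ : Δ.IsRational) {d : ℕ} {Γ : Fan ℚ (κ → ℚ)}
    (hΓ : Γ.cones = Δ.stageCones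
      {φ | φ ∈ Δ.cones ∧ d < Module.finrank ℚ (Submodule.span ℚ (φ : Set (κ → ℚ)))})
    {φ₀ φ₀' : PointedCone ℚ (κ → ℚ)} (hφ₀ : φ₀ ∈ Δ.cones)
    (hd₀ : Module.finrank ℚ (Submodule.span ℚ (φ₀ : Set (κ → ℚ))) = d) (hφ₀' : φ₀' ∈ Δ.cones)
    (hd₀' : Module.finrank ℚ (Submodule.span ℚ (φ₀' : Set (κ → ℚ))) = d)
    {σ : PointedCone ℚ (κ → ℚ)} (hσ : σ ∈ Γ.cones) (hb : bary φ₀ ∈ σ) (hb' : bary φ₀' ∈ σ) :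
    φ₀ = φ₀' := by
  obtain ⟨h𝒰, hup⟩ := upward_dimGt (Δ := Δ) d
  obtain ⟨-, h1, h2⟩ := batch_dimEq (Δ := Δ) hφ₀ hd₀
  obtain ⟨-, h1', h2'⟩ := batch_dimEq (Δ := Δ) hφ₀' hd₀'
  exact stage_separated hΔ h𝒰 hup hΓ hφ₀ h1 h2 hφ₀' h1' h2' hσ hb hb'

/-- At the top stage (`d` at least the ambient dimension) nothing is starred: the stage cones are
the cones of `Δ`. [cite: KempfEtAl1973, II §2] -/
theorem stageCones_dimTop {d : ℕ} (hd : Fintype.card κ ≤ d) :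
    Δ.stageCones {φ | φ ∈ Δ.cones ∧ d < Module.finrank ℚ (Submodule.span ℚ (φ : Set (κ → ℚ)))} =
      Δ.cones := by
  have hemp : {φ | φ ∈ Δ.cones ∧ d < Module.finrank ℚ (Submodule.span ℚ (φ : Set (κ → ℚ)))} = ∅ := by
    ext φ
    simp only [Set.mem_setOf_eq, Set.mem_empty_iff_false, iff_false, not_and, not_lt]
    intro _
    calc Module.finrank ℚ (Submodule.span ℚ (φ : Set (κ → ℚ)))
        ≤ Module.finrank ℚ (κ → ℚ) := Submodule.finrank_le _
      _ = Fintype.card κ := Module.finrank_fintype_fun_eq_card ℚ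
      _ ≤ d := hd
  rw [hemp, stageCones_empty]

/-- **The flag fan.** At stage `0` the stage cones are exactly the flag cones of the chains of
nonzero cones of `Δ` ([KempfEtAl1973] II §2: the cells of the barycentric subdivision).
[cite: KempfEtAl1973, II §2] -/
theorem stageCones_dimZero_iff (hne : Δ.cones.Nonempty) {σ : PointedCone ℚ (κ → ℚ)} :
    σ ∈ Δ.stageCones {φ | φ ∈ Δ.cones ∧ 0 < Module.finrank ℚ (Submodule.span ℚ (φ : Set (κ → ℚ)))} ↔
      ∃ Φ : Finset (PointedCone ℚ (κ → ℚ)), (↑Φ ⊆ Δ.cones) ∧ ⊥ ∉ Φ ∧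
        IsChain (· ≤ ·) (Φ : Set (PointedCone ℚ (κ → ℚ))) ∧ σ = flagCone (Φ : Set (PointedCone ℚ (κ → ℚ))) := by
  have hzero : ∀ {φ : PointedCone ℚ (κ → ℚ)}, φ ∈ Δ.cones →
      (Module.finrank ℚ (Submodule.span ℚ (φ : Set (κ → ℚ))) = 0 ↔ φ = ⊥) := by
    intro φ _
    rw [Submodule.finrank_eq_zero, Submodule.span_eq_bot]
    constructor
    · intro h
      exact le_antisymm (fun x hx => (Submodule.mem_bot ℚ).mpr (h x hx)) bot_le
    · rintro rfl x hx
      exact (Submodule.mem_bot _).mp hx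
  obtain ⟨σ₀, hσ₀⟩ := hne
  have hbot : (⊥ : PointedCone ℚ (κ → ℚ)) ∈ Δ.cones := Δ.bot_mem hσ₀
  rw [mem_stageCones_iff]
  constructor
  · rintro ⟨ρ, hρ, hρ𝒰, Φ, hΦ, hΦch, -, rfl⟩
    have hρ0 : ρ = ⊥ := by
      have : ¬ 0 < Module.finrank ℚ (Submodule.span ℚ (ρ : Set (κ → ℚ))) := fun h => hρ𝒰 ⟨hρ, h⟩
      exact (hzero hρ).mp (Nat.eq_zero_of_not_pos this)
    subst hρ0
    refine ⟨Φ, fun φ hφ => (hΦ hφ).1, fun h0 => ?_, hΦch, by rw [bot_sup_eq]⟩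
    have := (hΦ (Finset.mem_coe.mpr h0)).2
    rw [(hzero hbot).mpr rfl] at this
    exact lt_irrefl 0 this
  · rintro ⟨Φ, hΦ, h0, hΦch, rfl⟩
    refine ⟨⊥, hbot, fun h => (lt_irrefl 0) (((hzero hbot).mpr rfl) ▸ h.2), Φ, fun φ hφ => ⟨hΦ hφ, ?_⟩,
      hΦch, fun φ _ => bot_le, by rw [bot_sup_eq]⟩
    rw [Nat.pos_iff_ne_zero, Ne, hzero (hΦ hφ)]
    exact fun h => h0 (h ▸ Finset.mem_coe.mp hφ)

/-- The stage-`0` fan (the FLAG FAN) is simplicial. [cite: KempfEtAl1973, II §2] -/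
theorem isSimplicial_of_dimZero (hΔ : Δ.IsRational) {Γ : Fan ℚ (κ → ℚ)}
    (hΓ : Γ.cones = Δ.stageCones
      {φ | φ ∈ Δ.cones ∧ 0 < Module.finrank ℚ (Submodule.span ℚ (φ : Set (κ → ℚ)))}) :
    Γ.IsSimplicial := by
  intro σ hσ
  rw [hΓ] at hσ
  have hne : Δ.cones.Nonempty := by
    obtain ⟨ρ, hρ, -⟩ := hσ
    exact ⟨ρ, hρ⟩
  obtain ⟨Φ, hΦ, h0, hch, rfl⟩ := (stageCones_dimZero_iff hne).mp hσ
  exact isSimplicial_flagCone hΔ hΦ h0 hch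

omit [Fintype κ] in
/-- **Membership / uniqueness for flag cones** (pv-2's (c), used for orbit separation): if a
positive combination `Σ_{φ ∈ Φ} λ_φ b_φ` over a chain `Φ` of nonzero cones of `Δ` lies in the flag
cone of a chain `Ψ` of nonzero cones, then `Φ ⊆ Ψ`. [cite: KempfEtAl1973, II §2] -/
theorem chain_subset_of_mem_flagCone (hΔ : Δ.IsRational) {Φ Ψ : Finset (PointedCone ℚ (κ → ℚ))}
    (hΦ : (↑Φ : Set (PointedCone ℚ (κ → ℚ))) ⊆ Δ.cones) (hΦ0 : ⊥ ∉ Φ)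
    (hΦch : IsChain (· ≤ ·) (Φ : Set (PointedCone ℚ (κ → ℚ))))
    (hΨ : (↑Ψ : Set (PointedCone ℚ (κ → ℚ))) ⊆ Δ.cones) (hΨ0 : ⊥ ∉ Ψ)
    (hΨch : IsChain (· ≤ ·) (Ψ : Set (PointedCone ℚ (κ → ℚ))))
    {lam : PointedCone ℚ (κ → ℚ) → ℚ} (hlam : ∀ φ ∈ Φ, 0 < lam φ)
    (hx : ∑ φ ∈ Φ, lam φ • bary φ ∈ flagCone (Ψ : Set (PointedCone ℚ (κ → ℚ)))) : Φ ⊆ Ψ := by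
  classical
  -- the starred set: all nonzero cones
  set 𝒰 : Set (PointedCone ℚ (κ → ℚ)) := {φ | φ ∈ Δ.cones ∧ φ ≠ ⊥} with h𝒰def
  have h𝒰 : 𝒰 ⊆ Δ.cones := fun φ hφ => hφ.1
  have hup : ∀ φ ∈ 𝒰, ∀ ψ ∈ Δ.cones, φ ≤ ψ → ψ ∈ 𝒰 := by
    intro φ hφ ψ hψ hle
    refine ⟨hψ, fun h => hφ.2 (le_antisymm (h ▸ hle) bot_le)⟩
  rcases Φ.eq_empty_or_nonempty with rfl | hne
  · exact Finset.empty_subset _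
  obtain ⟨φ₁, hφ₁⟩ := hne
  have hbotΔ : (⊥ : PointedCone ℚ (κ → ℚ)) ∈ Δ.cones := Δ.bot_mem (hΦ (Finset.mem_coe.mpr hφ₁))
  have hbot𝒰 : (⊥ : PointedCone ℚ (κ → ℚ)) ∉ 𝒰 := fun h => h.2 rfl
  have hΦ𝒰 : (↑Φ : Set (PointedCone ℚ (κ → ℚ))) ⊆ 𝒰 := fun φ hφ =>
    ⟨hΦ hφ, fun h => hΦ0 (h ▸ Finset.mem_coe.mp hφ)⟩
  have hΨ𝒰 : (↑Ψ : Set (PointedCone ℚ (κ → ℚ))) ⊆ 𝒰 := fun ψ hψ =>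
    ⟨hΨ hψ, fun h => hΨ0 (h ▸ Finset.mem_coe.mp hψ)⟩
  -- represent the point inside `⊥ + flagCone Ψ`
  have hx' : ∑ φ ∈ Φ, lam φ • bary φ ∈ (⊥ : PointedCone ℚ (κ → ℚ)) ⊔ flagCone (Ψ : Set _) := by
    rw [bot_sup_eq]; exact hx
  obtain ⟨r, hr, mu, hmu, hxr⟩ := exists_rep_of_mem_sup_flagCone hΔ hΨ hx'
  have hr0 : r = 0 := (Submodule.mem_bot ℚ).mp hr
  subst hr0
  set Ψp := Ψ.filter (fun ψ => 0 < mu ψ) with hΨp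
  have hΨpΨ : Ψp ⊆ Ψ := Finset.filter_subset _ _
  have heq : (0 : κ → ℚ) + ∑ φ ∈ Φ, lam φ • bary φ = 0 + ∑ ψ ∈ Ψp, mu ψ • bary ψ := by
    rw [hΨp, sum_filter_pos_eq hmu, zero_add]; exact hxr
  obtain ⟨hΦΨ, -, -⟩ := stageRep_unique hΔ h𝒰 hup _ le_rfl hbotΔ hbot𝒰 (Submodule.zero_mem _) hΦ𝒰
    hΦch (fun _ _ => bot_le) hlam hbotΔ hbot𝒰 (Submodule.zero_mem _)
    (fun ψ hψ => hΨ𝒰 (Finset.mem_coe.mpr (hΨpΨ (Finset.mem_coe.mp hψ))))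
    (hΨch.mono fun ψ hψ => Finset.mem_coe.mpr (hΨpΨ (Finset.mem_coe.mp hψ)))
    (fun _ _ => bot_le) (fun ψ hψ => (Finset.mem_filter.mp hψ).2) heq
  rw [hΦΨ]; exact hΨpΨ

end Dim

end Fan

end Literature.Geometry.PolyhedralFans

end
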